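import Mathlib
import Literature.NumberTheory.Congruences.ZolotarevLemma
import Literature.NumberTheory.Congruences.ZolotarevLemmaJacobi
import Literature.NumberTheory.Congruences.ZolotarevReciprocity
import Literature.NumberTheory.Congruences.PolynomialQuadraticReciprocity
import HarnessLib

/-!
# The Zolotarev symbol of `𝔽_q[t]/(gh)` is the product of those of `𝔽_q[t]/(g)` and `𝔽_q[t]/(h)`; Corollary 2.7
# (`[c / R/b] = (c/b)`, the Jacobi symbol) for `R = 𝔽_q[t]`
# (Brunyate–Clark, *Extending the Zolotarev–Frobenius approach to quadratic reciprocity*, §2.4 Theorem 2.6 (a), Corollary 2.7,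
# by "Cartier's approach to Corollary 2.7", §6 Theorem 6.2 (b))

Layer `Literature/NumberTheory/Congruences`, namespace `Literature.NumberTheory.Congruences.Zolotarev`; lane `lit-hodgefound`
(Track 2 foundations library), prover seat `lit-hodgefound-p06`, generation 50, self-proposed row g50-#6. Theorems only: no
definition, no instance, no notation, no named fact. Sequel of `PolynomialQuadraticReciprocity.lean` (g50-#1: representatives
`𝔽_q[t]_{<A} ≃ R/(a)`, `(x, y) ↦ bx + y`, `#R/(a) = q^{deg a}`, `a mod b` a unit for coprime `a, b`; Theorem 4.3 there is stated
with Zolotarev symbols `[a / R/(b)]` and, for irreducible `b` only, with the quadratic character) — this file identifies the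
Zolotarev symbol `[c / R/(b)]` of an ARBITRARY monic modulus `b = ∏ P_i^{e_i}` with the Jacobi symbol `∏ (c/P_i)^{e_i}` of
`𝔽_q[t]` (Rosen's `(c/b)_2`), by complete multiplicativity in the modulus.

## Source ([BrunyateClark2014], held `paper:doi-10-1007-s11139-014-9635-y`, pp. 11, 13, 20–21)

§2.4 "**Theorem 2.6.** Let `r` be a finite principal ring. a) If `r` is odd, then the Zolotarev symbol `[·/r]` is equal to the
Jacobi symbol `(·/r)`." with (§2.1) "`(a/r) = ∏_{i=1}^{r} (a/k_i)^{e_i}`" over the local factors `r_i` (residue fields `k_i`,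
lengths `e_i`), and "**Corollary 2.7.** Let `b` be an odd ideal in an abstract number ring `R`, and let `a ∈ R` be prime to
`b`. Then `[a / R/b] = (a/b)`." §6: "Cartier's approach to Corollary 2.7 uses the following result. Theorem 6.2. (Cartier) …
b) If `u` stabilizes a normal subgroup `N` of `G`, the signature of `u` on `G` is equal to the signature of `u` on `N` times the
signature of the induced automorphism on `G/N`." and "There are in fact several killing blows in the odd order case."
For `R = 𝔽_q[t]` (`q` odd), `G = (R/(gh), +)`, `u = (x ↦ cx)` and `N = (g)/(gh) ≅ R/(h)`, `G/N ≅ R/(g)`, Theorem 6.2 (b) reads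
`[c / R/(gh)] = [c / R/(g)] · [c / R/(h)]` for ALL monic `g, h` — which by induction on the factorisation of `b` and the first
Zolotarev lemma `[c / R/(P)] = (c/P)` (Lemma 2.5, the tree's `ZolotarevLemma.sign_toPerm_eq_quadraticChar`) is Corollary 2.7.

## What is typed

`[c / R/(b)]` is `Perm.sign (MulAction.toPerm u : Perm (AdjoinRoot b))` for a unit `u = c mod b` (as in the sibling files).
* **`sign_toPerm_adjoinRoot_mul`** — `[c / R/(gh)] = [c / R/(g)]·[c / R/(h)]` for monic `g, h` (no coprimality needed), `q` odd:
  Theorem 6.2 (b) in this instance, proved on the representatives `p = gx + y` (`deg x < deg h`, `deg y < deg g`), where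
  multiplication by `c` is `(x, y) ↦ (cx + (cy) /ₘ g mod h, cy mod g)` — `#R/(g)` maps "`z ↦ cz +` const" of `R/(h)` times
  `#R/(h)` copies of `y ↦ cy` on `R/(g)`; translations are even (Lemma 2.2 (b), `sign_addRight_eq_one_of_odd_card`) and the
  exponents `#R/(g)`, `#R/(h)` are odd;
* `sign_toPerm_adjoinRoot_pow` (`[c / R/(g^n)] = [c / R/(g)]^n`), **`sign_toPerm_adjoinRoot_pow_eq_quadraticChar_pow`**
  (COROLLARY 2.7 for prime powers: `[c / R/(P^e)] = (c/P)^e`), `sign_toPerm_adjoinRoot_eq_quadraticChar` (`e = 1`).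
TODO(general form): the packaged Jacobi symbol `(c/b) = ∏ (c/P_i)^{e_i}` of `𝔽_q[t]` as a definition (Rosen's `(a/b)_d`, `d = 2`)
is not in the tree; the two displayed theorems are its defining recursion, so `[c / R/(b)] = (c/b)` holds factor by factor.

## References

* [BrunyateClark2014] A. Brunyate, P. L. Clark, *Extending the Zolotarev–Frobenius approach to quadratic reciprocity*,
  Ramanujan J. 37 (2015) 25–50, §2.4 Thm. 2.6 (a), Cor. 2.7, §6 Thm. 6.2 (b).
* [RosenFunctionFields2002] M. Rosen, *Number Theory in Function Fields*, GTM 210 (2002), Ch. 3 (the residue symbols `(a/P)_d`,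
  `(a/b)_d`).
* P. Cartier, *Sur une généralisation des symboles de Legendre–Jacobi*, Enseignement Math. (2) 16 (1970) 31–48 ([Ca70] of the
  source).
-/

open Polynomial Equiv Equiv.Perm Finset

namespace Literature.NumberTheory.Congruences.Zolotarev

variable {F : Type*} [Field F] {g h c : F[X]}

/-- If `c mod g` is a unit of `R/(g)` then `c` and `g` are coprime (converse of `isUnit_mk_of_isCoprime`). [folklore] -/
private theorem isCoprime_of_isUnit_mk (hu : IsUnit (AdjoinRoot.mk g c)) : IsCoprime c g := by
  obtain ⟨u, hu⟩ := hu
  obtain ⟨s, hs⟩ := AdjoinRoot.mk_surjective (↑u⁻¹ : AdjoinRoot g)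
  have h1 : AdjoinRoot.mk g (c * s) = 1 := by rw [map_mul, ← hu, hs, Units.mul_inv]
  rw [← map_one (AdjoinRoot.mk g), AdjoinRoot.mk_eq_mk] at h1
  obtain ⟨t, ht⟩ := h1
  exact ⟨s, -t, by linear_combination ht⟩

variable [Fintype F]

/-- **The Zolotarev symbol is multiplicative in the modulus over `𝔽_q[t]`** (`q` odd): for monic `g, h` and `c` invertible
modulo `gh`, `[c / R/(gh)] = [c / R/(g)] · [c / R/(h)]`, `R = 𝔽_q[t]` — with NO coprimality assumption on `g, h`. This is
Cartier's route to Corollary 2.7 (Theorem 6.2 (b) for the additive group `G = R/(gh)`, `u = ` multiplication by `c`, and the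
`u`-stable subgroup `N = (g)/(gh) ≅ R/(h)` with `G/N ≅ R/(g)`), carried out on the representatives `p = gx + y` (`deg x < deg h`,
`deg y < deg g`): there multiplication by `c` reads `(x, y) ↦ (cx + (cy) /ₘ g mod h, cy mod g)`, a product of `#R/(g)` maps
"`z ↦ cz + const`" of `R/(h)` and `#R/(h)` copies of `y ↦ cy` on `R/(g)`; translations are even (Lemma 2.2 (b)) and
`#R/(g)`, `#R/(h)` are odd. [cite: BrunyateClark2014, §2.4 Cor. 2.7 with §6 Thm. 6.2 (b) ("Cartier's approach to Corollary 2.7")] -/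
theorem sign_toPerm_adjoinRoot_mul (hF : ringChar F ≠ 2) {m : F[X]} (hm : m = g * h) (hg : g.Monic) (hh : h.Monic)
    [Fintype (AdjoinRoot m)] [DecidableEq (AdjoinRoot m)] [Fintype (AdjoinRoot g)] [DecidableEq (AdjoinRoot g)]
    [Fintype (AdjoinRoot h)] [DecidableEq (AdjoinRoot h)]
    (u : (AdjoinRoot m)ˣ) (hu : (u : AdjoinRoot m) = AdjoinRoot.mk m c)
    (v : (AdjoinRoot g)ˣ) (hv : (v : AdjoinRoot g) = AdjoinRoot.mk g c)
    (w : (AdjoinRoot h)ˣ) (hw : (w : AdjoinRoot h) = AdjoinRoot.mk h c) :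
    Perm.sign (MulAction.toPerm u : Perm (AdjoinRoot m)) =
      Perm.sign (MulAction.toPerm v : Perm (AdjoinRoot g)) * Perm.sign (MulAction.toPerm w : Perm (AdjoinRoot h)) := by
  classical
  subst hm
  -- representatives: `R/(g) ≃ 𝔽_q[t]_{<A}`, `R/(h) ≃ 𝔽_q[t]_{<B}`, `R/(gh) ≃ 𝔽_q[t]_{<B+A}`, `p = gx + y`
  obtain ⟨ρg, hρg⟩ := exists_equiv_degreeLT_adjoinRoot hg (rfl : g.natDegree = g.natDegree)
  obtain ⟨ρh, hρh⟩ := exists_equiv_degreeLT_adjoinRoot hh (rfl : h.natDegree = h.natDegree)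
  obtain ⟨ρm, hρm⟩ := exists_equiv_degreeLT_adjoinRoot (hg.mul hh)
    (show (g * h).natDegree = h.natDegree + g.natDegree by rw [hg.natDegree_mul hh, add_comm])
  obtain ⟨L, hL, -⟩ := exists_linearEquiv_apply_eq_mul_add (R := F) hg rfl h.natDegree
  -- `Θ : R/(h) × R/(g) ≃ R/(gh)`, `(x̄, ȳ) ↦ gx + y mod gh`
  obtain ⟨Θ, hΘapply⟩ : ∃ Θ : AdjoinRoot h × AdjoinRoot g ≃ AdjoinRoot (g * h),
      ∀ x y, Θ (x, y) = AdjoinRoot.mk (g * h) (g * (ρh.symm x : F[X]) + (ρg.symm y : F[X])) :=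
    ⟨((ρh.prodCongr ρg).symm.trans L.toEquiv).trans ρm, fun x y => by
      rw [Equiv.trans_apply, Equiv.trans_apply, Equiv.prodCongr_symm, Equiv.prodCongr_apply, Prod.map_apply, hρm,
        LinearEquiv.coe_toEquiv, hL]⟩
  have hxg : ∀ x : AdjoinRoot g, AdjoinRoot.mk g ((ρg.symm x : F[X]_g.natDegree) : F[X]) = x := fun x => by
    rw [← hρg, Equiv.apply_symm_apply]
  have hxh : ∀ x : AdjoinRoot h, AdjoinRoot.mk h ((ρh.symm x : F[X]_h.natDegree) : F[X]) = x := fun x => by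
    rw [← hρh, Equiv.apply_symm_apply]
  -- the correcting translation `d(ȳ) = (c·y) /ₘ g mod h`
  set d : AdjoinRoot g → AdjoinRoot h := fun y => AdjoinRoot.mk h ((c * (ρg.symm y : F[X])) /ₘ g) with hd
  set τ : Perm (AdjoinRoot h × AdjoinRoot g) :=
    (prodCongrRight fun _ : AdjoinRoot h => (MulAction.toPerm v : Perm (AdjoinRoot g))) *
      prodCongrLeft fun y : AdjoinRoot g =>
        ((MulAction.toPerm w : Perm (AdjoinRoot h)).trans (Equiv.addRight (d y)) : Perm (AdjoinRoot h)) with hτ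
  -- `Θ ∘ τ = (x ↦ c x) ∘ Θ`
  have hcomm : ∀ p, Θ (τ p) = (MulAction.toPerm u : Perm (AdjoinRoot (g * h))) (Θ p) := by
    rintro ⟨x, y⟩
    rw [hτ, Perm.mul_apply, prodCongrLeft_apply, prodCongrRight_apply, Equiv.trans_apply, Equiv.coe_addRight,
      MulAction.toPerm_apply, MulAction.toPerm_apply, MulAction.toPerm_apply, Units.smul_def, Units.smul_def, Units.smul_def,
      smul_eq_mul, smul_eq_mul, smul_eq_mul, hv, hw, hu, hΘapply, hΘapply, ← map_mul, AdjoinRoot.mk_eq_mk]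
    -- `gh ∣ (g X' + Y') − c (g x + y)` where `X' ≡ cx + (cy)/ₘg (mod h)` and `Y' ≡ cy (mod g)`
    set x' : F[X] := (ρh.symm x : F[X]) with hx'
    set y' : F[X] := (ρg.symm y : F[X]) with hy'
    have hX : h ∣ (ρh.symm (AdjoinRoot.mk h c * x + d y) : F[X]) - (c * x' + (c * y') /ₘ g) := by
      rw [← AdjoinRoot.mk_eq_mk, hxh, map_add, map_mul, hxh x]
    -- the representative of `c̄ȳ` IS the remainder `(c y') %ₘ g`
    have hY : (ρg.symm (AdjoinRoot.mk g c * y) : F[X]) = (c * y') %ₘ g := by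
      have hmem : (c * y') %ₘ g ∈ F[X]_g.natDegree := by
        rw [mem_degreeLT, ← degree_eq_natDegree hg.ne_zero]
        exact degree_modByMonic_lt _ hg
      have key : ρg.symm (AdjoinRoot.mk g c * y) = ⟨(c * y') %ₘ g, hmem⟩ := by
        rw [Equiv.symm_apply_eq, hρg, ← hxg y, ← map_mul, AdjoinRoot.mk_eq_mk]
        show g ∣ c * y' - (c * y') %ₘ g
        exact ⟨(c * y') /ₘ g, by linear_combination -(modByMonic_add_div (c * y') g)⟩
      rw [key]
    obtain ⟨s, hs⟩ := hX
    have hmod := modByMonic_add_div (c * y') g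
    rw [hY]
    exact ⟨s, by linear_combination g * hs + hmod⟩
  have hcardg : Odd (Fintype.card (AdjoinRoot g)) := odd_card_adjoinRoot hF hg
  have hcardh : Odd (Fintype.card (AdjoinRoot h)) := odd_card_adjoinRoot hF hh
  apply Units.val_injective
  rw [← sign_eq_sign_of_equiv τ _ Θ hcomm, hτ, Perm.sign_mul, sign_prodCongrRight, sign_prodCongrLeft, Finset.prod_const,
    Finset.card_univ]
  simp_rw [Perm.sign_trans, sign_addRight_eq_one_of_odd_card hcardh, one_mul]
  rw [Finset.prod_const, Finset.card_univ, Units.val_mul, Units.val_mul, Units.val_pow_eq_pow_val, Units.val_pow_eq_pow_val,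
    units_int_pow_of_odd _ hcardh, units_int_pow_of_odd _ hcardg]

/-- Induction carrier for `sign_toPerm_adjoinRoot_pow` (instances for `R/(g^n)` quantified with `n`).
[cite: BrunyateClark2014, §2.4 Thm. 2.6 (a), proof Steps 2–3] -/
theorem sign_toPerm_adjoinRoot_pow_aux (hF : ringChar F ≠ 2) (hg : g.Monic) [Fintype (AdjoinRoot g)]
    [DecidableEq (AdjoinRoot g)] (v : (AdjoinRoot g)ˣ) (hv : (v : AdjoinRoot g) = AdjoinRoot.mk g c) (n : ℕ) :
    ∀ (_ : Fintype (AdjoinRoot (g ^ n))) (_ : DecidableEq (AdjoinRoot (g ^ n))) (u : (AdjoinRoot (g ^ n))ˣ),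
      (u : AdjoinRoot (g ^ n)) = AdjoinRoot.mk (g ^ n) c →
        ((Perm.sign (MulAction.toPerm u : Perm (AdjoinRoot (g ^ n))) : ℤˣ) : ℤ) =
          (Perm.sign (MulAction.toPerm v : Perm (AdjoinRoot g)) : ℤ) ^ n := by
  induction n with
  | zero =>
    intro _ _ u hu
    have hcard : Fintype.card (AdjoinRoot (g ^ 0)) = 1 := by
      rw [card_adjoinRoot (hg.pow 0), pow_zero, natDegree_one, pow_zero]
    haveI : Subsingleton (AdjoinRoot (g ^ 0)) := Fintype.card_le_one_iff_subsingleton.mp hcard.le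
    rw [Subsingleton.elim (MulAction.toPerm u : Perm (AdjoinRoot (g ^ 0))) 1, Perm.sign_one, Units.val_one, pow_zero]
  | succ n ih =>
    intro _ _ u hu
    classical
    haveI : Finite (AdjoinRoot (g ^ n)) := finite_adjoinRoot (hg.pow n)
    letI instF : Fintype (AdjoinRoot (g ^ n)) := Fintype.ofFinite _
    have hc : IsCoprime c g := isCoprime_of_isUnit_mk ⟨v, hv⟩
    obtain ⟨u', hu'⟩ := isUnit_mk_of_isCoprime (hc.pow_right (n := n))
    rw [sign_toPerm_adjoinRoot_mul hF (pow_succ g n) (hg.pow n) hg u hu u' hu' v hv, Units.val_mul,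
      ih instF inferInstance u' hu', pow_succ]

/-- **Powers: `[c / R/(g^n)] = [c / R/(g)]^n`** for monic `g ∈ 𝔽_q[t]` (`q` odd) and `c` invertible mod `g` (read in `ℤ`)
— the case `h = g^{n}` of multiplicativity, iterated ("`[a/r] = ∏ ϵ_i(a) = ϵ_ℓ(a)^{u−ℓ+1}`", Theorem 2.6 Step 2–3 for the local
factors of `𝔽_q[t]/(b)`). [cite: BrunyateClark2014, §2.4 Thm. 2.6 (a), proof Steps 2–3, and Cor. 2.7] -/
theorem sign_toPerm_adjoinRoot_pow (hF : ringChar F ≠ 2) (hg : g.Monic) [Fintype (AdjoinRoot g)] [DecidableEq (AdjoinRoot g)]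
    (v : (AdjoinRoot g)ˣ) (hv : (v : AdjoinRoot g) = AdjoinRoot.mk g c) (n : ℕ)
    [Fintype (AdjoinRoot (g ^ n))] [DecidableEq (AdjoinRoot (g ^ n))]
    (u : (AdjoinRoot (g ^ n))ˣ) (hu : (u : AdjoinRoot (g ^ n)) = AdjoinRoot.mk (g ^ n) c) :
    ((Perm.sign (MulAction.toPerm u : Perm (AdjoinRoot (g ^ n))) : ℤˣ) : ℤ) =
      (Perm.sign (MulAction.toPerm v : Perm (AdjoinRoot g)) : ℤ) ^ n :=
  sign_toPerm_adjoinRoot_pow_aux hF hg v hv n inferInstance inferInstance u hu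

/-- **COROLLARY 2.7 for `R = 𝔽_q[t]`, prime-power moduli: `[c / R/(P^e)] = (c/P)^e`**, `(c/P)` the Legendre symbol of
`𝔽_q[t]` = the quadratic character of `c mod P` in the field `R/(P)` (`P` monic irreducible, `q` odd, `c` prime to `P`): by the
first Zolotarev lemma `[c / R/(P)] = (c/P)` (`ZolotarevLemma.sign_toPerm_eq_quadraticChar`) and `sign_toPerm_adjoinRoot_pow`.
With `sign_toPerm_adjoinRoot_mul` this evaluates `[c / R/(b)]` for every `b = ∏ P_i^{e_i}` as the Jacobi symbol
`∏ (c/P_i)^{e_i}` of `𝔽_q[t]` ("If `r` is odd, then the Zolotarev symbol `[·/r]` is equal to the Jacobi symbol `(·/r)`").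
[cite: BrunyateClark2014, §2.4 Thm. 2.6 (a) and Cor. 2.7; RosenFunctionFields2002, Ch. 3 (the symbol `(a/b)_d`, d = 2)] -/
theorem sign_toPerm_adjoinRoot_pow_eq_quadraticChar_pow (hF : ringChar F ≠ 2) [Fact (Irreducible g)] (hg : g.Monic)
    (hc : IsCoprime c g) (n : ℕ) [Fintype (AdjoinRoot g)] [DecidableEq (AdjoinRoot g)]
    [Fintype (AdjoinRoot (g ^ n))] [DecidableEq (AdjoinRoot (g ^ n))]
    (u : (AdjoinRoot (g ^ n))ˣ) (hu : (u : AdjoinRoot (g ^ n)) = AdjoinRoot.mk (g ^ n) c) :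
    ((Perm.sign (MulAction.toPerm u : Perm (AdjoinRoot (g ^ n))) : ℤˣ) : ℤ) =
      quadraticChar (AdjoinRoot g) (AdjoinRoot.mk g c) ^ n := by
  obtain ⟨v, hv⟩ := isUnit_mk_of_isCoprime hc
  have hFg : ringChar (AdjoinRoot g) ≠ 2 := by rwa [← Algebra.ringChar_eq F (AdjoinRoot g)]
  rw [sign_toPerm_adjoinRoot_pow hF hg v hv n u hu, sign_toPerm_eq_quadraticChar hFg v, hv]

omit [Fintype F] in
/-- **COROLLARY 2.7 for `R = 𝔽_q[t]`, prime moduli** (`e = 1`, the first Zolotarev lemma in the notation of this file):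
`[c / R/(P)] = (c/P)`, the quadratic character of `c mod P`. [cite: BrunyateClark2014, §2.3 Lemma 2.5 and §2.4 Cor. 2.7] -/
theorem sign_toPerm_adjoinRoot_eq_quadraticChar (hF : ringChar F ≠ 2) [Fact (Irreducible g)]
    [Fintype (AdjoinRoot g)] [DecidableEq (AdjoinRoot g)] (v : (AdjoinRoot g)ˣ) (hv : (v : AdjoinRoot g) = AdjoinRoot.mk g c) :
    ((Perm.sign (MulAction.toPerm v : Perm (AdjoinRoot g)) : ℤˣ) : ℤ) = quadraticChar (AdjoinRoot g) (AdjoinRoot.mk g c) := by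
  have hFg : ringChar (AdjoinRoot g) ≠ 2 := by rwa [← Algebra.ringChar_eq F (AdjoinRoot g)]
  rw [sign_toPerm_eq_quadraticChar hFg v, hv]

end Literature.NumberTheory.Congruences.Zolotarev
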